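import Summits.BirchSwinnertonDyer.BirchSwinnertonDyer.Theorems.ByReductionTypeAtTwoOrdMissingLowerBoundOfLambdaHalf
import Summits.BirchSwinnertonDyer.BirchSwinnertonDyer.Theorems.ByReductionTypeAtTwoOrdEisensteinHalfEquivalence
import Summits.BirchSwinnertonDyer.BirchSwinnertonDyer.Theorems.ByReductionTypeAtTwoMultUpperHalfParity
import Summits.BirchSwinnertonDyer.BirchSwinnertonDyer.Theorems.PrintX8VerticalStevensIrreducible
import Summits.BirchSwinnertonDyer.BirchSwinnertonDyer.Theorems.PrintX8VSConjSpanGenAll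
import Summits.BirchSwinnertonDyer.Rank1Residual.F1Sign2.BranchCongruenceModTwoAtTwo
import Literature.NumberTheory.EllipticCurves.ModularCurvePeriodRatio
import Literature.NumberTheory.EllipticCurves.ModularCurve
import Literature.NumberTheory.EllipticCurves.ModularSymbolsProofs
import Literature.NumberTheory.EllipticCurves.IsogenyCompProofs
import Literature.NumberTheory.EllipticCurves.Zhai2021.TwoAdicLowerBoundTwists
import Summits.BirchSwinnertonDyer.BirchSwinnertonDyer.Theses.ByReductionTypeAtTwo
import Summits.BirchSwinnertonDyer.BirchSwinnertonDyer.Theses.TwoAdicConverse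
import Literature.NumberTheory.EllipticCurves.IsogenyIdProofs
import HarnessLib

/-!
# Crux `OrdMissingLowerBoundAtTwo` (stmt-BirchSwinnertonDyer-19577) — crux idea `odd-point-shimura-descent-two`
# SKETCH v2 (ideator 2/2, GEN 7, round 2): S3 REPAIRED AND PROVED (modulo the named span residual at `P = 4`),
# the depth-`s` Shimura 2-descent TYPED, and the reducible-locus target of line L1 reached by a kernel-checked
# EXTREMAL-MEMBER argument (no tower iteration).

HONEST FRAMING.  BSD is NOT proved here; the crux 19577 is NOT closed here; nothing below asserts an open
statement.  What is PROVED (sorry-free) in this file: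

* `factorsThroughD_of_conjSpanGen` — the GENERIC span criterion: `ConjSpanGen N P` ⟹ every homomorphism
  `Γ₀(N) → A` (abelian) killing finite-order, trace-`±2` and `|d| = Pᵐ` elements is a function of `d mod N`
  (the tree's `criterion'_of_conjSpanGen` with `2 ↦ P`, `ZMod 2 ↦ A`);
* `eisenstein_of_multiFlat` — **S3 at every depth**: an integer period functional `m_f` (`plusPeriod f ≠ 0`,
  so `f ≠ 0` — this answers both triage `stub-misstated` findings `TRIAGE_r2_1_S3hole.lean` /
  `S3DegenerateZeroForm.lean`) that is `2^s`-FLAT of slope `sl` (`m_f(γ) ≡ k·sl (mod 2^s)` whenever `|d(γ)| = 2ᵏ`)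
  is EISENSTEIN mod `2^s` (`m_f ≡ χ∘d`), GIVEN `ConjSpanGen N (2 ^ addOrderOf sl)`; at depth 1 this is
  `eisensteinModTwo_of_twoFlat`: even type `sl = 0` UNCONDITIONAL (tree THEOREM B `conjSpanGen_holds` at
  `p = 2`), alternating type `sl = 1` from `ConjSpanGen N 4` (THEOREM B′, the named residual `SpanGenFour`);
* `not_onPlateauAtTwo_iff` — pen U3: `¬ OnPlateauAtTwo W ↔ HasRationalRamifiedOddTwoTorsion W` (L1's decls verbatim);
* `analyticMuNonpos_of_onPlateau_optimal` — the `t = 0` rung (= L1's `stub_analyticMuNonposOnPlateau` at the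
  optimal curve) from S1, S2, `ConjSpanGen N 4`, S4 — S3 is NO LONGER A HYPOTHESIS;
* `reducibleWitness_of_extremal` / `reducibleWitnessByDescentAtTwo_of` — pen U4: the FULL reducible-locus target
  `ReducibleWitnessByDescentAtTwo` (GEN 6) from the depth-`s` pieces by an EXTREMAL argument: take a member
  `W''` of the class whose Néron period is `2^s·Ω(E₀)` with `s` MAXIMAL; a rational ramified odd point on `W''`
  would give period `2^{s+1}·Ω(E₀)` (DD jump), and `μ^{Nér}(W'') ≥ 1` would give `μ(L₂(f, Ω⁺_f)) ≥ s+1`, hence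
  (S2_{s+1} ∘ S3_{s+1} ∘ S4_{s+1}) again a member of period `2^{s+1}·Ω(E₀)` — so `W''` is ON THE PLATEAU with
  `μ^{Nér} ≤ 0`.  No induction on the tower, no «alternating stage» case (GEN 6's R3 is dissolved).

WHAT IS TYPED, NOT PROVED (the line's stubs): S1 `OptimalPeriodUnitAtTwo` (print: Abbes–Ullmo + Edixhoven),
S2_s `MultiFlatOfMuAtTwo` (MSD bookkeeping incl. the valuation facts `v₂(α−1) ∈ {1,2}`, `sl = (a₂−3)·c`,
`addOrderOf sl ∣ 4`), S4_s `PeriodDescentOfEisensteinAtTwo` (THE LEVER at depth `s`: `m_f ≡ χ∘d (mod 2^s)` on the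
optimal curve ⟹ a ℚ-isogenous curve of Néron period `2^s·Ω(E₀)` — via `π₀^*C_s = μ_{2^s} ⊆` the generalised
Shimura subgroup, optimality, Abbes–Ullmo closed immersion, canonical subgroup), the residual `SpanGenAtTwo`
(`ConjSpanGen N 4 ∧ ConjSpanGen N 16` — `16` only in the corner `a₂ = −1, v₂(c) = s−4`), and three bookkeeping /
print items `MuTransportAtTwo`, `PeriodIndexMaxAtTwo` (finiteness of the isogeny class), `PeriodDoublesOfRamifiedOdd`
(DD jump law), `OptimalMemberAtTwo` (modularity + optimal curve + multiplicity one).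

WHY `ConjSpanGen N 4` IS NOT A COROLLARY OF THE TREE'S PROOF (pen U1): the orbit trick runs in `SL₂(ℤ[1/P])` and
its step `h2_concrete` uses `ℤ ∩ ℤ[1/P]ˣ = ±P^ℕ` (`natAbs_eq_pow_of_isUnit_intCast`, `P` prime); for `P = 4`,
`ℤ[1/4] = ℤ[1/2]` has integer units `±2^ℕ ⊋ ±4^ℕ`, so the decomposition produces `|d| = 2^{odd}` elements that
are NOT generators of `spanSubgroup N 4`.  B′ is therefore a genuine residual (kit-tested, see the card).
-/

set_option autoImplicit false
set_option linter.dupNamespace false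

noncomputable section

open scoped Classical MatrixGroups ModularForm

open CongruenceSubgroup WeierstrassCurve Literature.NumberTheory.EllipticCurves
  Literature.NumberTheory.EllipticCurves.ModularForms Literature.NumberTheory.EllipticCurves.Rank1Residual
  Literature.NumberTheory.EllipticCurves.Rank1Residual.Typed
  Literature.NumberTheory.EllipticCurves.Greenberg1999
  Literature.NumberTheory.EllipticCurves.Zhai2021
  Summit.BirchSwinnertonDyer.Rank1Residual.X1.MuLambda
  Summit.BirchSwinnertonDyer.Rank1Residual.X1.MuPart
  Summit.BirchSwinnertonDyer.Rank1Residual.X5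
  Summit.BirchSwinnertonDyer.Rank1Residual.X5.O1
  Summit.BirchSwinnertonDyer.Rank1Residual
  Summit.BirchSwinnertonDyer.BirchSwinnertonDyer.Theorems.TwoAdicTwistConverse
  Summit.BirchSwinnertonDyer.BirchSwinnertonDyer.Theorems.EisensteinLowerBounds
  Summit.BirchSwinnertonDyer.BirchSwinnertonDyer.Theorems.EisensteinShaCurrency
  Summit.BirchSwinnertonDyer.BirchSwinnertonDyer.Theorems.IsogenyMuShift
  Summit.BirchSwinnertonDyer.BirchSwinnertonDyer.Theorems.PrintX8VerticalStevens
  Summit.BirchSwinnertonDyer.BirchSwinnertonDyer.Theorems.PrintX8VSConjSpanGenAll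

namespace Summit.BirchSwinnertonDyer.BirchSwinnertonDyer.Cruxes.OrdMissingLowerBoundAtTwo.OddPointShimuraDescentTwo

/-! ## §0 Copies of L1's two definitions (verbatim from `Lines/kato_free_lower_sandwich_two.lean`) -/

/-- (copy of L1's decl) **`μ_an^{Nér}(E) ≤ 0`** in slack form. -/
def AnalyticMuNonpos (W : WeierstrassCurve ℚ) [W.IsElliptic] [W.IsGloballyMinimal] : Prop :=
  ∀ [NeZero (W.conductorNorm ℤ)] (f : CuspForm (Gamma0 (W.conductorNorm ℤ)) 2), IsNewformOf W f →
    ∀ (ϖ : ℚ), (ϖ : ℝ) * W.realPeriodRat = plusPeriod f →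
    ∀ (j : ℕ) (L₀ : IwasawaAlgebra 2),
      iwasawaToPowerSeries 2 L₀ =
        PowerSeries.C (((2 : ℚ) ^ j * ϖ : ℚ) : ℚ_[2]) * padicLFunction f (unitRoot W 2 : ℚ_[2]) →
      mu L₀ ≤ j

/-- (copy of L1's decl) **`W` lies on the top plateau of its isogeny class at `2`**. -/
def OnPlateauAtTwo (W : WeierstrassCurve ℚ) : Prop :=
  ∀ x : ℚ, HasRationalTwoTorsionX W x → ¬ (TwoTorsionRamifiedAtTwo x ∧ TwoTorsionOdd W x)

/-! ## §1 Vocabulary -/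

/-- `μ(ϖ·L₂(f,α)) ≥ s` WITNESSED (`s = 1`: GEN 6's `MuPosFor`). -/
def MuAtLeastFor (W : WeierstrassCurve ℚ) [W.IsElliptic] [W.IsGloballyMinimal] [NeZero (W.conductorNorm ℤ)]
    (f : CuspForm (Gamma0 (W.conductorNorm ℤ)) 2) (s : ℕ) : Prop :=
  ∃ (ϖ : ℚ) (j : ℕ) (L₀ : IwasawaAlgebra 2), (ϖ : ℝ) * W.realPeriodRat = plusPeriod f ∧
    iwasawaToPowerSeries 2 L₀ =
      PowerSeries.C (((2 : ℚ) ^ j * ϖ : ℚ) : ℚ_[2]) * padicLFunction f (unitRoot W 2 : ℚ_[2]) ∧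
    j + s ≤ mu L₀

/-- GEN 6's `MuPosFor` is depth `1`. -/
def MuPosFor (W : WeierstrassCurve ℚ) [W.IsElliptic] [W.IsGloballyMinimal] [NeZero (W.conductorNorm ℤ)]
    (f : CuspForm (Gamma0 (W.conductorNorm ℤ)) 2) : Prop :=
  MuAtLeastFor W f 1

/-- Logic: `¬ AnalyticMuNonpos W` produces a newform `f` of `W` with `MuPosFor W f`. -/
theorem exists_muPosFor_of_not_analyticMuNonpos (W : WeierstrassCurve ℚ) [W.IsElliptic]
    [W.IsGloballyMinimal] [NeZero (W.conductorNorm ℤ)] (h : ¬ AnalyticMuNonpos W) :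
    ∃ f : CuspForm (Gamma0 (W.conductorNorm ℤ)) 2, IsNewformOf W f ∧ MuPosFor W f := by
  by_contra hc
  apply h
  intro _ f hf ϖ hϖ j L₀ hL
  by_contra hle
  exact hc ⟨f, hf, ϖ, j, L₀, hϖ, hL, Nat.succ_le_of_lt (not_le.mp hle)⟩

/-- The **integer period functional** `m_f : Γ₀(N) → ℤ`, `re{∞, γ∞}_f = m_f(γ)·Ω⁺_f/2`. -/
def IsIntegerFunctional {N : ℕ} (f : CuspForm (Gamma0 N) 2) (m : Gamma0 N → ℤ) : Prop :=
  ∀ γ : Gamma0 N, (cuspSymbol f γ).re = m γ * (plusPeriod f / 2)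

/-- **`q`-FLAT winding profile of slope `sl`**: `m(γ) ≡ k·sl (mod q)` whenever `|d(γ)| = 2ᵏ`. -/
def MultiFlatWith {N : ℕ} (m : Gamma0 N → ℤ) (q : ℕ) (sl : ZMod q) : Prop :=
  ∀ (γ : Gamma0 N) (k : ℕ), (dEntry γ).natAbs = 2 ^ k → ((m γ : ℤ) : ZMod q) = (k : ZMod q) * sl

/-- GEN 6's `TwoFlatWith` is `MultiFlatWith m 2` (verbatim body). -/
def TwoFlatWith {N : ℕ} (m : Gamma0 N → ℤ) (ε : ZMod 2) : Prop :=
  ∀ (γ : Gamma0 N) (k : ℕ), (dEntry γ).natAbs = 2 ^ k → ((m γ : ℤ) : ZMod 2) = (k : ZMod 2) * ε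

theorem twoFlatWith_iff {N : ℕ} (m : Gamma0 N → ℤ) (ε : ZMod 2) :
    TwoFlatWith m ε ↔ MultiFlatWith m 2 ε := Iff.rfl

/-- **`m` is EISENSTEIN mod `q`**: `m ≡ χ∘(d mod N)` for a bare function `χ` (it is then automatically a
character of `(ℤ/N)ˣ` killing `−1` and the `d`-entries of elliptic / parabolic elements, since `m` is a
homomorphism killing those). -/
def IsEisensteinMod {N : ℕ} (q : ℕ) (m : Gamma0 N → ℤ) (χ : ZMod N → ZMod q) : Prop :=
  ∀ γ : Gamma0 N, ((m γ : ℤ) : ZMod q) = χ (Gamma0Map N γ)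

/-- THEOREM B′: `ConjSpanGen N 4` at every odd level (NOT in the tree; NOT a corollary of its proof). -/
def SpanGenFour : Prop := ∀ N : ℕ, Odd N → ConjSpanGen N 4

/-- The full span residual of the depth-`s` descent: `P = 4` and `P = 16` (never `8`, never `≥ 32`). -/
def SpanGenAtTwo : Prop := ∀ N : ℕ, Odd N → ConjSpanGen N 4 ∧ ConjSpanGen N 16

/-- A rational point of order `2` that is BOTH ramified at `2` and odd. -/
def HasRationalRamifiedOddTwoTorsion (W : WeierstrassCurve ℚ) : Prop :=
  ∃ x : ℚ, HasRationalTwoTorsionX W x ∧ TwoTorsionRamifiedAtTwo x ∧ TwoTorsionOdd W x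

/-- **Pen U3 (PROVED): the plateau dictionary.** -/
theorem not_onPlateauAtTwo_iff (W : WeierstrassCurve ℚ) :
    ¬ OnPlateauAtTwo W ↔ HasRationalRamifiedOddTwoTorsion W := by
  constructor
  · intro h
    by_contra hc
    exact h fun x hx hro => hc ⟨x, hx, hro.1, hro.2⟩
  · rintro ⟨x, hx, hr, ho⟩ hplat
    exact hplat x hx ⟨hr, ho⟩

theorem not_onPlateauAtTwo_of_hasRationalRamifiedOdd (W : WeierstrassCurve ℚ)
    (h : HasRationalRamifiedOddTwoTorsion W) : ¬ OnPlateauAtTwo W :=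
  (not_onPlateauAtTwo_iff W).2 h

/-- `Ω(W'') = 2^s · Ω(E₀)` — the PERIOD INDEX of a class member relative to the optimal curve. -/
def PeriodIndexAtTwo (E₀ W'' : WeierstrassCurve ℚ) [E₀.IsElliptic] [W''.IsElliptic] (s : ℕ) : Prop :=
  W''.realPeriodRat = (2 : ℝ) ^ s * E₀.realPeriodRat

/-! ## §2 S3 PROVED: the generic span criterion and the Eisenstein property of flat functionals -/

/-- **Generic span criterion** (`criterion'_of_conjSpanGen` of `HorocycleSpanModTwoSketch5.lean` with
`2 ↦ P`, `ZMod 2 ↦ A`): under `ConjSpanGen N P`, a homomorphism to an abelian group killing finite-order,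
trace-`±2` and `|d| = Pᵐ` elements is a function of `d mod N`. -/
theorem factorsThroughD_of_conjSpanGen {N P : ℕ} {A : Type*} [CommGroup A] (h : ConjSpanGen N P)
    (κ : Gamma0 N →* A) (hfin : ∀ γ : Gamma0 N, IsOfFinOrder γ → κ γ = 1)
    (htr : ∀ γ : Gamma0 N, trEntry γ = 2 ∨ trEntry γ = -2 → κ γ = 1)
    (hgood : ∀ γ : Gamma0 N, IsGoodAt P γ → κ γ = 1) :
    ∃ χ : ZMod N → A, ∀ γ : Gamma0 N, κ γ = χ (Gamma0Map N γ) := by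
  have hker : spanSubgroup N P ≤ κ.ker := by
    rw [spanSubgroup]
    refine sup_le ?_ (Abelianization.commutator_subset_ker κ)
    rw [Subgroup.closure_le]
    intro γ hγ
    simp only [spanGenerators, Set.mem_setOf_eq] at hγ
    rw [SetLike.mem_coe, MonoidHom.mem_ker]
    rcases hγ with hg | hf | ht | ht
    · exact hgood γ hg
    · exact hfin γ hf
    · exact htr γ (Or.inl ht)
    · exact htr γ (Or.inr ht)
  have hΓ₁ : ∀ γ : Gamma0 N, γ ∈ Gamma1' N → κ γ = 1 := fun γ hγ =>
    (MonoidHom.mem_ker).1 (hker ((conjSpanGen_iff_gamma1 N P).1 h γ hγ))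
  refine ⟨fun x => if hx : ∃ γ : Gamma0 N, Gamma0Map N γ = x then κ hx.choose else 1, fun γ => ?_⟩
  have hx : ∃ γ' : Gamma0 N, Gamma0Map N γ' = Gamma0Map N γ := ⟨γ, rfl⟩
  dsimp only
  rw [dif_pos hx]
  set c : Gamma0 N := hx.choose with hc_def
  have hc : Gamma0Map N c = Gamma0Map N γ := hx.choose_spec
  have e1 : Gamma0Map N (γ * c⁻¹) * Gamma0Map N c = Gamma0Map N γ := by
    rw [← map_mul, inv_mul_cancel_right]
  have e2 : Gamma0Map N c * Gamma0Map N c⁻¹ = 1 := by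
    rw [← map_mul, mul_inv_cancel, map_one]
  have hmem : γ * c⁻¹ ∈ Gamma1' N := by
    rw [Gamma1_mem']
    calc Gamma0Map N (γ * c⁻¹)
        = Gamma0Map N (γ * c⁻¹) * (Gamma0Map N c * Gamma0Map N c⁻¹) := by rw [e2, mul_one]
      _ = Gamma0Map N γ * Gamma0Map N c⁻¹ := by rw [← mul_assoc, e1]
      _ = Gamma0Map N c * Gamma0Map N c⁻¹ := by rw [hc]
      _ = 1 := e2
  have hκ : κ (γ * c⁻¹) = 1 := hΓ₁ _ hmem
  rw [map_mul, map_inv, mul_inv_eq_one] at hκ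
  exact hκ

section Functional

variable {N : ℕ} [NeZero N] (f : CuspForm (Gamma0 N) 2)

/-- An integer period functional of a form with `Ω⁺_f ≠ 0` is ADDITIVE (Manin: `cuspSymbol_mul_holds`). -/
theorem IsIntegerFunctional.map_mul {m : Gamma0 N → ℤ} (hm : IsIntegerFunctional f m)
    (hΩ : plusPeriod f ≠ 0) (γ δ : Gamma0 N) : m (γ * δ) = m γ + m δ := by
  have h := hm (γ * δ)
  rw [cuspSymbol_mul_holds f γ δ, Complex.add_re, hm γ, hm δ] at h
  have hΩ2 : plusPeriod f / 2 ≠ 0 := div_ne_zero hΩ two_ne_zero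
  have : ((m (γ * δ) : ℤ) : ℝ) = (m γ : ℝ) + (m δ : ℝ) := by
    have := mul_right_cancel₀ hΩ2 (h.symm.trans (by ring : (m γ : ℝ) * (plusPeriod f / 2) +
      (m δ : ℝ) * (plusPeriod f / 2) = ((m γ : ℝ) + (m δ : ℝ)) * (plusPeriod f / 2)))
    exact this
  exact_mod_cast this

omit [NeZero N] in
/-- It kills every element on which `{∞, γ∞}_f` vanishes. -/
theorem IsIntegerFunctional.eq_zero_of_cuspSymbol {m : Gamma0 N → ℤ} (hm : IsIntegerFunctional f m)
    (hΩ : plusPeriod f ≠ 0) {γ : Gamma0 N} (h0 : cuspSymbol f γ = 0) : m γ = 0 := by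
  have h := hm γ
  rw [h0, Complex.zero_re] at h
  have hΩ2 : plusPeriod f / 2 ≠ 0 := div_ne_zero hΩ two_ne_zero
  have : (m γ : ℝ) = 0 := by
    rcases mul_eq_zero.1 h.symm with h1 | h1
    · exact h1
    · exact absurd h1 hΩ2
  exact_mod_cast this

/-- The functional as a homomorphism to `Multiplicative (ZMod q)`. -/
def functionalHom {m : Gamma0 N → ℤ} (hm : IsIntegerFunctional f m) (hΩ : plusPeriod f ≠ 0) (q : ℕ) :
    Gamma0 N →* Multiplicative (ZMod q) where
  toFun γ := Multiplicative.ofAdd (((m γ : ℤ) : ZMod q))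
  map_one' := by
    have h1 : m 1 = 0 := hm.eq_zero_of_cuspSymbol f hΩ (cuspSymbol_one f)
    simp [h1]
  map_mul' γ δ := by
    rw [hm.map_mul f hΩ γ δ, ← ofAdd_add]
    push_cast
    rfl

@[simp] theorem functionalHom_apply {m : Gamma0 N → ℤ} (hm : IsIntegerFunctional f m)
    (hΩ : plusPeriod f ≠ 0) (q : ℕ) (γ : Gamma0 N) :
    functionalHom f hm hΩ q γ = Multiplicative.ofAdd (((m γ : ℤ) : ZMod q)) := rfl

/-- **S3 at depth `s` (PROVED modulo the span input it names).**  A `q`-flat integer period functional of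
slope `sl` is Eisenstein mod `q`, given `ConjSpanGen N (2 ^ addOrderOf sl)` — the good elements for
`P = 2^{ord sl}` have `|d| = 2^{ord sl · j}`, on which `m ≡ (ord sl · j)·sl = 0`. -/
theorem eisenstein_of_multiFlat {m : Gamma0 N → ℤ} (hm : IsIntegerFunctional f m) (hΩ : plusPeriod f ≠ 0)
    {q : ℕ} (sl : ZMod q) (hflat : MultiFlatWith m q sl)
    (hspan : ConjSpanGen N (2 ^ addOrderOf sl)) :
    ∃ χ : ZMod N → ZMod q, IsEisensteinMod q m χ := by
  have hfin : ∀ γ : Gamma0 N, IsOfFinOrder γ → functionalHom f hm hΩ q γ = 1 := by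
    intro γ hγ
    rw [functionalHom_apply, hm.eq_zero_of_cuspSymbol f hΩ (cuspSymbol_eq_zero_of_isOfFinOrder f hγ)]
    simp
  have htr : ∀ γ : Gamma0 N, trEntry γ = 2 ∨ trEntry γ = -2 → functionalHom f hm hΩ q γ = 1 := by
    intro γ hγ
    rw [functionalHom_apply, hm.eq_zero_of_cuspSymbol f hΩ (cuspSymbol_eq_zero_of_trEntry f hγ)]
    simp
  have hgood : ∀ γ : Gamma0 N, IsGoodAt (2 ^ addOrderOf sl) γ → functionalHom f hm hΩ q γ = 1 := by
    rintro γ ⟨j, hj⟩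
    rw [← pow_mul] at hj
    rw [functionalHom_apply, hflat γ _ hj]
    have h0 : ((addOrderOf sl * j : ℕ) : ZMod q) * sl = 0 := by
      rw [← nsmul_eq_mul]
      exact (addOrderOf_dvd_iff_nsmul_eq_zero).1 (dvd_mul_right _ _)
    rw [h0]
    rfl
  obtain ⟨χ, hχ⟩ := factorsThroughD_of_conjSpanGen hspan (functionalHom f hm hΩ q) hfin htr hgood
  refine ⟨fun x => Multiplicative.toAdd (χ x), fun γ => ?_⟩
  have := hχ γ
  rw [functionalHom_apply] at this
  show ((m γ : ℤ) : ZMod q) = Multiplicative.toAdd (χ (Gamma0Map N γ))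
  rw [← this]
  rfl

/-- **S3 at depth 1 = the repaired `EisensteinOfTwoFlatAtTwo`** (pen U1 / both triage sharpenings): even type
UNCONDITIONAL (tree THEOREM B at `p = 2`), alternating type from `ConjSpanGen N 4`. -/
theorem eisensteinModTwo_of_twoFlat (hN : Odd N) {m : Gamma0 N → ℤ} (hm : IsIntegerFunctional f m)
    (hΩ : plusPeriod f ≠ 0) (ε : ZMod 2) (hflat : TwoFlatWith m ε) (hB' : ε = 1 → ConjSpanGen N 4) :
    ∃ χ : ZMod N → ZMod 2, IsEisensteinMod 2 m χ := by
  have hε2 : ∀ e : ZMod 2, e = 0 ∨ e = 1 := by decide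
  have hε : ε = 0 ∨ ε = 1 := hε2 ε
  refine eisenstein_of_multiFlat f hm hΩ ε ((twoFlatWith_iff m ε).1 hflat) ?_
  rcases hε with rfl | rfl
  · rw [addOrderOf_zero, pow_one]
    exact conjSpanGen_holds Nat.prime_two hN.not_two_dvd_nat
  · rw [ZMod.addOrderOf_one]
    exact hB' rfl

end Functional

/-- The repaired S3 as a closed statement (χ-function form, `plusPeriod f ≠ 0`, B′ internalised as a
hypothesis of the alternating case) — and its proof. -/
def EisensteinOfTwoFlatAtTwoR : Prop :=
  ∀ (N : ℕ) [NeZero N] (f : CuspForm (Gamma0 N) 2) (m : Gamma0 N → ℤ) (ε : ZMod 2), Odd N →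
    plusPeriod f ≠ 0 → IsIntegerFunctional f m → TwoFlatWith m ε → (ε = 1 → ConjSpanGen N 4) →
    ∃ χ : ZMod N → ZMod 2, IsEisensteinMod 2 m χ

theorem eisensteinOfTwoFlatAtTwoR_holds : EisensteinOfTwoFlatAtTwoR :=
  fun _ _ f _ ε hN hΩ hm hflat hB' => eisensteinModTwo_of_twoFlat f hN hm hΩ ε hflat hB'

/-! ## §3 The pieces of the line, typed (NOT proved here) -/

/-- **S1 (PRINT — Abbes–Ullmo 1996 Thm. A at `p = 2 ∤ N` + Edixhoven 1991 Prop. 2).**  For the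
`X₀(N)`-optimal curve at odd level the Néron period is a `2`-adic unit times `Ω⁺_f`, and `Ω⁺_f ≠ 0`. -/
def OptimalPeriodUnitAtTwo : Prop :=
  ∀ (W : WeierstrassCurve ℚ) [W.IsElliptic] [W.IsGloballyMinimal] [NeZero (W.conductorNorm ℤ)]
    (D : ModularParametrizationData W (W.conductorNorm ℤ)), IsOptimalDatum W D → Odd (W.conductorNorm ℤ) →
    plusPeriod D.f ≠ 0 ∧ ∃ u : ℚ, ‖((u : ℚ) : ℚ_[2])‖ = 1 ∧ W.realPeriodRat = u * plusPeriod D.f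

/-- **S2_s (BOOKKEEPING — the Mazur–Swinnerton-Dyer measure at `2` to depth `s`; size M).**  With
`ν_n(a) := 2μ_{f,α}(a+2ⁿℤ₂)/Ω⁺_f = α^{-(n+1)}(α·w_n(a) − w_{n−1}(a) + κ)`, `w_n(a) = m_f(γ)` for `d(γ) = ±2ⁿ`,
`κ = (α−1)·c`, `c = 2L(f,1)/Ω⁺_f`, `w₀ = 0`, `w₁ = (a₂−3)·c`:  `μ ≥ s` ⟺ `2^s ∣ κ(α−1)` and
`w_n(a) ≡ n·w₁ (mod 2^s)` for all `n, a` (the recursion `α·w_n ≡ w_{n−1} − κ` has the solution `n·w₁` because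
`w₁(α−1) = κ(1−β)(α−1) ≡ 0` and `w₁ + κ = κβ(α−1) ≡ 0`).  So the profile is `2^s`-FLAT of slope `sl = w̄₁`, and
since `v₂(α−1) = 1` (`a₂ = 1`) or `2` (`a₂ = −1`), `v₂(sl) ≥ s − 2`: `addOrderOf sl ∣ 4`. -/
def MultiFlatOfMuAtTwo : Prop :=
  ∀ (W : WeierstrassCurve ℚ) [W.IsElliptic] [W.IsGloballyMinimal] [NeZero (W.conductorNorm ℤ)]
    (f : CuspForm (Gamma0 (W.conductorNorm ℤ)) 2) (s : ℕ), IsNewformOf W f → GoodOrd W 2 →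
    (∃ u : ℚ, ‖((u : ℚ) : ℚ_[2])‖ = 1 ∧ W.realPeriodRat = u * plusPeriod f) → MuAtLeastFor W f s →
    ∃ (m : Gamma0 (W.conductorNorm ℤ) → ℤ) (sl : ZMod (2 ^ s)),
      IsIntegerFunctional f m ∧ MultiFlatWith m (2 ^ s) sl ∧ addOrderOf sl ∣ 4

/-- **S4_s (THE LEVER at depth `s` — odd-point / Shimura-subgroup duality; NEW, size L; print at prime `N`
for `s = 1`: Stein–Watkins 2004 Lemma 3.1 / Prop. 3.2, Mazur 1977 II.11).**  On the `X₀(N)`-optimal curve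
`E₀` (`N` odd): if `m_f ≡ χ∘d (mod 2^s)` then `C_s := ker(m_f mod 2^s) ⊆ E₀[2^s]` (Weil duality) satisfies
`π₀^*C_s = ker(J₀(N) → Jac X_χ) ≅ μ_{2^s}` for the étale cyclic cover `X_χ → X₀(N)` cut out by `χ` (`χ` kills
`−1` and the `d`-entries of elliptic and parabolic elements because `m_f` does), so `C_s` is a ℚ-RATIONAL CYCLIC
subgroup of order `2^s` (optimality: `π₀^*` injective), inside the FORMAL GROUP at `2` (Abbes–Ullmo: `E₀ → J₀(N)`
is a closed immersion of Néron models over `ℤ₂`; `μ_{2^s}` is connected), generated by odd points at each step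
(`m_f` is the real-part functional); dividing by it step by step is a chain of `s` ramified-odd `2`-isogenies,
each DOUBLING the Néron period (DD jump law): a ℚ-isogenous curve of period `2^s·Ω(E₀)`. -/
def PeriodDescentOfEisensteinAtTwo : Prop :=
  ∀ (W : WeierstrassCurve ℚ) [W.IsElliptic] [W.IsGloballyMinimal] [NeZero (W.conductorNorm ℤ)]
    (D : ModularParametrizationData W (W.conductorNorm ℤ)) (m : Gamma0 (W.conductorNorm ℤ) → ℤ) (s : ℕ)
    (χ : ZMod (W.conductorNorm ℤ) → ZMod (2 ^ s)),
    IsOptimalDatum W D → Odd (W.conductorNorm ℤ) → IsIntegerFunctional D.f m → IsEisensteinMod (2 ^ s) m χ →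
    ∃ (W'' : WeierstrassCurve ℚ) (_ : W''.IsElliptic) (_ : W''.IsGloballyMinimal),
      IsIsogenous W W'' ∧ PeriodIndexAtTwo W W'' s

/-- **S4 at depth 1 in GEN 6's shape** (a rational RAMIFIED ODD point of order 2 on the optimal curve itself):
the `s = 1` case of the lever, kept because it is literally what the `t = 0` rung consumes. -/
def RamifiedOddOfEisensteinAtTwo : Prop :=
  ∀ (W : WeierstrassCurve ℚ) [W.IsElliptic] [W.IsGloballyMinimal] [NeZero (W.conductorNorm ℤ)]
    (D : ModularParametrizationData W (W.conductorNorm ℤ)) (m : Gamma0 (W.conductorNorm ℤ) → ℤ)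
    (χ : ZMod (W.conductorNorm ℤ) → ZMod 2),
    IsOptimalDatum W D → Odd (W.conductorNorm ℤ) → IsIntegerFunctional D.f m → IsEisensteinMod 2 m χ →
    HasRationalRamifiedOddTwoTorsion W

/-- **T (BOOKKEEPING, size S/M): `μ` transport along the class.**  If `Ω(W'') = 2^s·Ω(E₀)` and
`μ^{Nér}(W'') ≥ 1` then `μ(ϖ₀·L₂(f,α)) ≥ s + 1` for the period ratio `ϖ₀` of `E₀` (same newform
`IsNewformOf.of_isIsogenous`, same unit root `unitRoot_eq_of_isIsogenous`, `ϖ'' = ϖ₀/2^s`). -/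
def MuTransportAtTwo : Prop :=
  ∀ (E₀ W'' : WeierstrassCurve ℚ) [E₀.IsElliptic] [E₀.IsGloballyMinimal] [W''.IsElliptic]
    [W''.IsGloballyMinimal] [NeZero (E₀.conductorNorm ℤ)] (f : CuspForm (Gamma0 (E₀.conductorNorm ℤ)) 2)
    (s : ℕ), IsNewformOf E₀ f → IsIsogenous E₀ W'' → PeriodIndexAtTwo E₀ W'' s → ¬ AnalyticMuNonpos W'' →
    MuAtLeastFor E₀ f (s + 1)

/-- **M (PRINT: an isogeny class over ℚ is finite; + `Ω(E₀) ≠ 0`): a member of MAXIMAL period index exists.** -/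
def PeriodIndexMaxAtTwo : Prop :=
  ∀ (E₀ : WeierstrassCurve ℚ) [E₀.IsElliptic] [E₀.IsGloballyMinimal],
    ∃ (W'' : WeierstrassCurve ℚ) (_ : W''.IsElliptic) (_ : W''.IsGloballyMinimal) (s : ℕ),
      IsIsogenous E₀ W'' ∧ PeriodIndexAtTwo E₀ W'' s ∧
      ∀ (W₃ : WeierstrassCurve ℚ) [W₃.IsElliptic] [W₃.IsGloballyMinimal] (s₃ : ℕ),
        IsIsogenous E₀ W₃ → PeriodIndexAtTwo E₀ W₃ s₃ → s₃ ≤ s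

/-- **DD (PRINT — Dokchitser–Dokchitser jump law at `2` / Greenberg LNM 1716 §5): dividing by a rational
ramified odd point of order `2` DOUBLES the Néron real period.** -/
def PeriodDoublesOfRamifiedOdd : Prop :=
  ∀ (W : WeierstrassCurve ℚ) [W.IsElliptic] [W.IsGloballyMinimal], HasRationalRamifiedOddTwoTorsion W →
    ∃ (W' : WeierstrassCurve ℚ) (_ : W'.IsElliptic) (_ : W'.IsGloballyMinimal),
      IsIsogenous W W' ∧ W'.realPeriodRat = 2 * W.realPeriodRat

/-- **O (PRINT: modularity + the optimal curve of a class + multiplicity one + good reduction at 2 ⟹ odd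
conductor, isogeny-invariant).**  Every good-ordinary-at-2 class has an `X₀(N)`-optimal member `E₀` at odd
level whose every newform carries an optimal datum. -/
def OptimalMemberAtTwo : Prop :=
  ∀ (W : WeierstrassCurve ℚ) [W.IsElliptic] [W.IsGloballyMinimal], GoodOrd W 2 →
    ∃ (E₀ : WeierstrassCurve ℚ) (_ : E₀.IsElliptic) (_ : E₀.IsGloballyMinimal) (_ : NeZero (E₀.conductorNorm ℤ)),
      IsIsogenous W E₀ ∧ Odd (E₀.conductorNorm ℤ) ∧ GoodOrd E₀ 2 ∧
      Nonempty (ModularParametrizationData E₀ (E₀.conductorNorm ℤ)) ∧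
      ∀ f : CuspForm (Gamma0 (E₀.conductorNorm ℤ)) 2, IsNewformOf E₀ f →
        ∃ D : ModularParametrizationData E₀ (E₀.conductorNorm ℤ), D.f = f ∧ IsOptimalDatum E₀ D

/-! ## §4 Compositions (PROVED) -/

/-- `addOrderOf sl ∣ 4` leaves `P ∈ {2, 4, 16}`; the tree has `2`, the residual supplies `4` and `16`. -/
theorem conjSpanGen_of_addOrderOf_dvd_four {N q : ℕ} (hN : Odd N) (h4 : ConjSpanGen N 4)
    (h16 : ConjSpanGen N 16) (sl : ZMod q) (hsl : addOrderOf sl ∣ 4) : ConjSpanGen N (2 ^ addOrderOf sl) := by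
  have hle : addOrderOf sl ≤ 4 := Nat.le_of_dvd (by norm_num) hsl
  interval_cases h : addOrderOf sl
  · exact absurd hsl (by decide)
  · simpa using conjSpanGen_holds Nat.prime_two hN.not_two_dvd_nat
  · simpa using h4
  · exact absurd hsl (by decide)
  · simpa using h16

/-- **The `t = 0` rung (= L1's `stub_analyticMuNonposOnPlateau` at the optimal curve), S3 discharged:**
S1, S2 (depth 1), `ConjSpanGen N 4`, S4 ⟹ an optimal good-ordinary curve of odd conductor ON THE PLATEAU has
`μ_an^{Nér} ≤ 0`. -/
theorem analyticMuNonpos_of_onPlateau_optimal (h1 : OptimalPeriodUnitAtTwo) (h2 : MultiFlatOfMuAtTwo)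
    (h4 : RamifiedOddOfEisensteinAtTwo)
    (W : WeierstrassCurve ℚ) [W.IsElliptic] [W.IsGloballyMinimal] [NeZero (W.conductorNorm ℤ)]
    (hN : Odd (W.conductorNorm ℤ)) (hB' : ConjSpanGen (W.conductorNorm ℤ) 4) (hgo : GoodOrd W 2)
    (hopt : ∀ f : CuspForm (Gamma0 (W.conductorNorm ℤ)) 2, IsNewformOf W f →
      ∃ D : ModularParametrizationData W (W.conductorNorm ℤ), D.f = f ∧ IsOptimalDatum W D)
    (hplat : OnPlateauAtTwo W) : AnalyticMuNonpos W := by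
  by_contra hμ
  obtain ⟨f, hf, hpos⟩ := exists_muPosFor_of_not_analyticMuNonpos W hμ
  obtain ⟨D, hDf, hD⟩ := hopt f hf
  subst hDf
  obtain ⟨hΩ, u, hu, hΩu⟩ := h1 W D hD hN
  obtain ⟨m, sl, hm, hflat, -⟩ := h2 W D.f 1 hf hgo ⟨u, hu, hΩu⟩ hpos
  obtain ⟨χ, hχ⟩ := eisensteinModTwo_of_twoFlat D.f hN hm hΩ sl
    ((twoFlatWith_iff m sl).2 (by simpa using hflat)) (fun _ => hB')
  exact not_onPlateauAtTwo_of_hasRationalRamifiedOdd W (h4 W D m χ hD hN hm hχ) hplat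

/-- **Pen U4 — the reducible-locus witness by the EXTREMAL member (no tower induction).**  For an optimal
good-ordinary `E₀` of odd conductor: the class member of MAXIMAL period index is on the plateau and has
`μ_an^{Nér} ≤ 0`. -/
theorem reducibleWitness_of_extremal (h1 : OptimalPeriodUnitAtTwo) (h2 : MultiFlatOfMuAtTwo)
    (hspan : SpanGenAtTwo) (h4 : PeriodDescentOfEisensteinAtTwo) (hT : MuTransportAtTwo)
    (hM : PeriodIndexMaxAtTwo) (hDD : PeriodDoublesOfRamifiedOdd)
    (E₀ : WeierstrassCurve ℚ) [E₀.IsElliptic] [E₀.IsGloballyMinimal] [NeZero (E₀.conductorNorm ℤ)]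
    (hN : Odd (E₀.conductorNorm ℤ)) (hgo : GoodOrd E₀ 2)
    (hD₀ : Nonempty (ModularParametrizationData E₀ (E₀.conductorNorm ℤ)))
    (hopt : ∀ f : CuspForm (Gamma0 (E₀.conductorNorm ℤ)) 2, IsNewformOf E₀ f →
      ∃ D : ModularParametrizationData E₀ (E₀.conductorNorm ℤ), D.f = f ∧ IsOptimalDatum E₀ D) :
    ∃ (W'' : WeierstrassCurve ℚ) (_ : W''.IsElliptic) (_ : W''.IsGloballyMinimal),
      IsIsogenous E₀ W'' ∧ OnPlateauAtTwo W'' ∧ AnalyticMuNonpos W'' := by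
  obtain ⟨W'', hE'', hM'', s, hiso, hidx, hmax⟩ := hM E₀
  refine ⟨W'', hE'', hM'', hiso, ?_, ?_⟩
  · -- plateau: a rational ramified odd point would raise the period index to `s + 1`
    by_contra hplat
    obtain ⟨W', hE', hM', hiso', hΩ'⟩ := hDD W'' ((not_onPlateauAtTwo_iff W'').1 hplat)
    have hidx' : PeriodIndexAtTwo E₀ W' (s + 1) := by
      unfold PeriodIndexAtTwo at hidx ⊢
      rw [hΩ', hidx, pow_succ]; ring
    have := hmax W' (s + 1) (IsIsogenous.trans' hiso hiso') hidx'
    omega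
  · -- μ: `μ^{Nér}(W'') ≥ 1` ⟹ `μ(ϖ₀ L) ≥ s+1` ⟹ flat ⟹ Eisenstein mod 2^{s+1} ⟹ a member of index `s + 1`
    by_contra hμ
    obtain ⟨D₀⟩ := hD₀
    have hf : IsNewformOf E₀ D₀.f := D₀.isNewformOf
    obtain ⟨D, hDf, hD⟩ := hopt D₀.f hf
    have hmu : MuAtLeastFor E₀ D.f (s + 1) := by rw [hDf]; exact hT E₀ W'' D₀.f s hf hiso hidx hμ
    obtain ⟨hΩ, u, hu, hΩu⟩ := h1 E₀ D hD hN
    obtain ⟨m, sl, hm, hflat, hsl⟩ := h2 E₀ D.f (s + 1) (hDf ▸ hf) hgo ⟨u, hu, hΩu⟩ hmu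
    obtain ⟨χ, hχ⟩ := eisenstein_of_multiFlat D.f hm hΩ sl hflat
      (conjSpanGen_of_addOrderOf_dvd_four hN (hspan _ hN).1 (hspan _ hN).2 sl hsl)
    obtain ⟨W₃, hE₃, hM₃, hiso₃, hidx₃⟩ := h4 E₀ D m (s + 1) χ hD hN hm hχ
    have := hmax W₃ (s + 1) hiso₃ hidx₃
    omega

/-- (GEN 6 target, verbatim) every non-CM, analytic-rank-0, good-ordinary-at-2 curve with a rational point of
order `2` is isogenous to a PLATEAU member with `μ_an^{Nér} ≤ 0`. -/
def ReducibleWitnessByDescentAtTwo : Prop :=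
  ∀ (W : WeierstrassCurve ℚ) [W.IsElliptic] [W.IsGloballyMinimal],
    ¬ W.HasCM → W.analyticRank = 0 → GoodOrd W 2 → (∃ x : ℚ, HasRationalTwoTorsionX W x) →
    ∃ (W'' : WeierstrassCurve ℚ) (_ : W''.IsElliptic) (_ : W''.IsGloballyMinimal),
      IsIsogenous W W'' ∧ OnPlateauAtTwo W'' ∧ AnalyticMuNonpos W''

/-- **The full reducible-locus target from the typed pieces (PROVED).** -/
theorem reducibleWitnessByDescentAtTwo_of (h1 : OptimalPeriodUnitAtTwo) (h2 : MultiFlatOfMuAtTwo)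
    (hspan : SpanGenAtTwo) (h4 : PeriodDescentOfEisensteinAtTwo) (hT : MuTransportAtTwo)
    (hM : PeriodIndexMaxAtTwo) (hDD : PeriodDoublesOfRamifiedOdd) (hO : OptimalMemberAtTwo) :
    ReducibleWitnessByDescentAtTwo := by
  intro W _ _ _ _ hgo _
  obtain ⟨E₀, hE₀, hM₀, hNZ, hiso₀, hN, hgo₀, hD₀, hopt⟩ := hO W hgo
  obtain ⟨W'', hE'', hM'', hiso, hplat, hμ⟩ :=
    reducibleWitness_of_extremal h1 h2 hspan h4 hT hM hDD E₀ hN hgo₀ hD₀ hopt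
  exact ⟨W'', hE'', hM'', IsIsogenous.trans' hiso₀ hiso, hplat, hμ⟩

/-- Logic (GEN 6): the descent target + the irreducible-locus supply give L1's analytic hypothesis `hμ`. -/
theorem hμ_of_descentWitness (hdesc : ReducibleWitnessByDescentAtTwo)
    (hirr : ∀ (W : WeierstrassCurve ℚ) [W.IsElliptic] [W.IsGloballyMinimal],
      ¬ W.HasCM → W.analyticRank = 0 → GoodOrd W 2 → (∀ x : ℚ, ¬ HasRationalTwoTorsionX W x) →
      AnalyticMuNonpos W) :
    ∀ (W : WeierstrassCurve ℚ) [W.IsElliptic] [W.IsGloballyMinimal], ¬ W.HasCM →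
      W.analyticRank = 0 → GoodOrd W 2 →
      ∃ (W'' : WeierstrassCurve ℚ) (_ : W''.IsElliptic) (_ : W''.IsGloballyMinimal),
        IsIsogenous W W'' ∧ AnalyticMuNonpos W'' := by
  intro W _ _ hcm hr hgo
  by_cases h2 : ∃ x : ℚ, HasRationalTwoTorsionX W x
  · obtain ⟨W'', hE, hM, hiso, -, hμ⟩ := hdesc W hcm hr hgo h2
    exact ⟨W'', hE, hM, hiso, hμ⟩
  · simp only [not_exists] at h2
    exact ⟨W, ‹_›, ‹_›, IsIsogenous.refl_holds W, hirr W hcm hr hgo h2⟩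

/-- **The whole reducible half of L1's `hμ` from: 2 print facts (S1, DD), 3 bookkeeping items (S2_s, T, M, O),
1 group-theoretic residual (B′: `P = 4, 16`) and ONE new arithmetic statement (S4_s).** -/
theorem hμ_of_pieces (h1 : OptimalPeriodUnitAtTwo) (h2 : MultiFlatOfMuAtTwo) (hspan : SpanGenAtTwo)
    (h4 : PeriodDescentOfEisensteinAtTwo) (hT : MuTransportAtTwo) (hM : PeriodIndexMaxAtTwo)
    (hDD : PeriodDoublesOfRamifiedOdd) (hO : OptimalMemberAtTwo)
    (hirr : ∀ (W : WeierstrassCurve ℚ) [W.IsElliptic] [W.IsGloballyMinimal],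
      ¬ W.HasCM → W.analyticRank = 0 → GoodOrd W 2 → (∀ x : ℚ, ¬ HasRationalTwoTorsionX W x) →
      AnalyticMuNonpos W) :
    ∀ (W : WeierstrassCurve ℚ) [W.IsElliptic] [W.IsGloballyMinimal], ¬ W.HasCM →
      W.analyticRank = 0 → GoodOrd W 2 →
      ∃ (W'' : WeierstrassCurve ℚ) (_ : W''.IsElliptic) (_ : W''.IsGloballyMinimal),
        IsIsogenous W W'' ∧ AnalyticMuNonpos W'' :=
  hμ_of_descentWitness (reducibleWitnessByDescentAtTwo_of h1 h2 hspan h4 hT hM hDD hO) hirr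


/-! ## §5 (GEN 7, round 2 — triage seat 2's remark on B′) The residual in its load-bearing ODD-INDEX form

A functional with values in a `2`-GROUP consumes only this: some ODD power of every `γ ∈ Γ_{⟨±P⟩}(N)` lies in
the span subgroup (through Manin 1972 Prop. 1.4: `[pr Γ_H(N) : V(N,P)]` is finite and odd).  It is implied by
`ConjSpanGen N P` (`m = 1`) and is NOT the tree's `EisSpanGen N 4` (`¬ 4 ∣ m` allows `m = 2`). -/

/-- **B′ (odd-index form).** -/
def OddSpanGen (N P : ℕ) : Prop :=
  ∀ γ : Gamma0 N, InGammaH N P γ → ∃ m : ℕ, Odd m ∧ γ ^ m ∈ spanSubgroup N P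

theorem oddSpanGen_of_conjSpanGen {N P : ℕ} (h : ConjSpanGen N P) : OddSpanGen N P :=
  fun γ hγ => ⟨1, odd_one, by rw [pow_one]; exact h γ hγ⟩

/-- The odd-index residual at `2`: `P = 4` and `P = 16` (cf. `SpanGenAtTwo`). -/
def OddSpanGenAtTwo : Prop := ∀ N : ℕ, Odd N → OddSpanGen N 4 ∧ OddSpanGen N 16

theorem oddSpanGenAtTwo_of_spanGenAtTwo (h : SpanGenAtTwo) : OddSpanGenAtTwo :=
  fun N hN => ⟨oddSpanGen_of_conjSpanGen (h N hN).1, oddSpanGen_of_conjSpanGen (h N hN).2⟩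

/-- The factorisation step isolated: a homomorphism to an abelian group that is trivial on `Γ₁(N)` is a
function of `d mod N`. -/
theorem factorsThroughD_of_gamma1 {N : ℕ} {A : Type*} [CommGroup A] (κ : Gamma0 N →* A)
    (hΓ₁ : ∀ γ : Gamma0 N, γ ∈ Gamma1' N → κ γ = 1) :
    ∃ χ : ZMod N → A, ∀ γ : Gamma0 N, κ γ = χ (Gamma0Map N γ) := by
  refine ⟨fun x => if hx : ∃ γ : Gamma0 N, Gamma0Map N γ = x then κ hx.choose else 1, fun γ => ?_⟩
  have hx : ∃ γ' : Gamma0 N, Gamma0Map N γ' = Gamma0Map N γ := ⟨γ, rfl⟩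
  dsimp only
  rw [dif_pos hx]
  set c : Gamma0 N := hx.choose with hc_def
  have hc : Gamma0Map N c = Gamma0Map N γ := hx.choose_spec
  have e1 : Gamma0Map N (γ * c⁻¹) * Gamma0Map N c = Gamma0Map N γ := by
    rw [← map_mul, inv_mul_cancel_right]
  have e2 : Gamma0Map N c * Gamma0Map N c⁻¹ = 1 := by
    rw [← map_mul, mul_inv_cancel, map_one]
  have hmem : γ * c⁻¹ ∈ Gamma1' N := by
    rw [Gamma1_mem']
    calc Gamma0Map N (γ * c⁻¹)
        = Gamma0Map N (γ * c⁻¹) * (Gamma0Map N c * Gamma0Map N c⁻¹) := by rw [e2, mul_one]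
      _ = Gamma0Map N γ * Gamma0Map N c⁻¹ := by rw [← mul_assoc, e1]
      _ = Gamma0Map N c * Gamma0Map N c⁻¹ := by rw [hc]
      _ = 1 := e2
  have hκ : κ (γ * c⁻¹) = 1 := hΓ₁ _ hmem
  rw [map_mul, map_inv, mul_inv_eq_one] at hκ
  exact hκ

/-- **Generic span criterion, odd-index form**: under `OddSpanGen N P`, a homomorphism to an abelian
`2`-torsion group killing finite-order, trace-`±2` and `|d| = Pᵐ` elements is a function of `d mod N`. -/
theorem factorsThroughD_of_oddSpanGen {N P : ℕ} {A : Type*} [CommGroup A] (h : OddSpanGen N P)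
    (hA : ∀ a : A, ∃ k : ℕ, a ^ (2 ^ k) = 1)
    (κ : Gamma0 N →* A) (hfin : ∀ γ : Gamma0 N, IsOfFinOrder γ → κ γ = 1)
    (htr : ∀ γ : Gamma0 N, trEntry γ = 2 ∨ trEntry γ = -2 → κ γ = 1)
    (hgood : ∀ γ : Gamma0 N, IsGoodAt P γ → κ γ = 1) :
    ∃ χ : ZMod N → A, ∀ γ : Gamma0 N, κ γ = χ (Gamma0Map N γ) := by
  have hker : spanSubgroup N P ≤ κ.ker := by
    rw [spanSubgroup]
    refine sup_le ?_ (Abelianization.commutator_subset_ker κ)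
    rw [Subgroup.closure_le]
    intro γ hγ
    simp only [spanGenerators, Set.mem_setOf_eq] at hγ
    rw [SetLike.mem_coe, MonoidHom.mem_ker]
    rcases hγ with hg | hf | ht | ht
    · exact hgood γ hg
    · exact hfin γ hf
    · exact htr γ (Or.inl ht)
    · exact htr γ (Or.inr ht)
  refine factorsThroughD_of_gamma1 κ fun γ hγ => ?_
  obtain ⟨m, hm, hmem⟩ := h γ (inGammaH_of_mem_gamma1 P hγ)
  obtain ⟨k, hk⟩ := hA (κ γ)
  have h1 : κ γ ^ m = 1 := by
    rw [← map_pow]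
    exact (MonoidHom.mem_ker).1 (hker hmem)
  have h2 := (pow_gcd_eq_one (a := κ γ) (m := m) (n := 2 ^ k)).2 ⟨h1, hk⟩
  rwa [Nat.Coprime.gcd_eq_one (Nat.Coprime.pow_right k (Nat.coprime_two_right.2 hm)), pow_one] at h2

section FunctionalOdd

variable {N : ℕ} [NeZero N] (f : CuspForm (Gamma0 N) 2)

/-- **S3 at depth `s` from the ODD-INDEX residual** (`Multiplicative (ZMod (2^s))` is a `2`-group). -/
theorem eisenstein_of_multiFlat_odd {m : Gamma0 N → ℤ} (hm : IsIntegerFunctional f m)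
    (hΩ : plusPeriod f ≠ 0) (s : ℕ) (sl : ZMod (2 ^ s)) (hflat : MultiFlatWith m (2 ^ s) sl)
    (hspan : OddSpanGen N (2 ^ addOrderOf sl)) :
    ∃ χ : ZMod N → ZMod (2 ^ s), IsEisensteinMod (2 ^ s) m χ := by
  have hfin : ∀ γ : Gamma0 N, IsOfFinOrder γ → functionalHom f hm hΩ (2 ^ s) γ = 1 := by
    intro γ hγ
    rw [functionalHom_apply, hm.eq_zero_of_cuspSymbol f hΩ (cuspSymbol_eq_zero_of_isOfFinOrder f hγ)]
    simp
  have htr : ∀ γ : Gamma0 N, trEntry γ = 2 ∨ trEntry γ = -2 →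
      functionalHom f hm hΩ (2 ^ s) γ = 1 := by
    intro γ hγ
    rw [functionalHom_apply, hm.eq_zero_of_cuspSymbol f hΩ (cuspSymbol_eq_zero_of_trEntry f hγ)]
    simp
  have hgood : ∀ γ : Gamma0 N, IsGoodAt (2 ^ addOrderOf sl) γ →
      functionalHom f hm hΩ (2 ^ s) γ = 1 := by
    rintro γ ⟨j, hj⟩
    rw [← pow_mul] at hj
    rw [functionalHom_apply, hflat γ _ hj]
    have h0 : ((addOrderOf sl * j : ℕ) : ZMod (2 ^ s)) * sl = 0 := by
      rw [← nsmul_eq_mul]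
      exact (addOrderOf_dvd_iff_nsmul_eq_zero).1 (dvd_mul_right _ _)
    rw [h0]
    rfl
  have hA : ∀ a : Multiplicative (ZMod (2 ^ s)), ∃ k : ℕ, a ^ (2 ^ k) = 1 := fun a => ⟨s, by
    have : (2 ^ s : ℕ) • (Multiplicative.toAdd a) = 0 := by
      rw [nsmul_eq_mul]; simp
    exact this⟩
  obtain ⟨χ, hχ⟩ :=
    factorsThroughD_of_oddSpanGen hspan hA (functionalHom f hm hΩ (2 ^ s)) hfin htr hgood
  refine ⟨fun x => Multiplicative.toAdd (χ x), fun γ => ?_⟩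
  have := hχ γ
  rw [functionalHom_apply] at this
  show ((m γ : ℤ) : ZMod (2 ^ s)) = Multiplicative.toAdd (χ (Gamma0Map N γ))
  rw [← this]
  rfl

/-- **S3 at depth 1 from the odd-index residual**: even type unconditional, alternating type from
`OddSpanGen N 4`. -/
theorem eisensteinModTwo_of_twoFlat_odd (hN : Odd N) {m : Gamma0 N → ℤ} (hm : IsIntegerFunctional f m)
    (hΩ : plusPeriod f ≠ 0) (ε : ZMod 2) (hflat : TwoFlatWith m ε) (hB' : ε = 1 → OddSpanGen N 4) :
    ∃ χ : ZMod N → ZMod 2, IsEisensteinMod 2 m χ := by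
  have hε2 : ∀ e : ZMod 2, e = 0 ∨ e = 1 := by decide
  rcases hε2 ε with rfl | rfl
  · exact eisensteinModTwo_of_twoFlat f hN hm hΩ 0 hflat (fun h => absurd h zero_ne_one)
  · have h4 : OddSpanGen N (2 ^ addOrderOf (1 : ZMod (2 ^ 1))) := by
      rw [ZMod.addOrderOf_one]
      exact hB' rfl
    exact eisenstein_of_multiFlat_odd f hm hΩ 1 1 ((twoFlatWith_iff m 1).1 hflat) h4

end FunctionalOdd

end Summit.BirchSwinnertonDyer.BirchSwinnertonDyer.Cruxes.OrdMissingLowerBoundAtTwo.OddPointShimuraDescentTwo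

end
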